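import Literature.MathematicalPhysics.QuantumFieldTheory.ConformalBootstrap3D.TwoSignHeadCells
import Literature.MathematicalPhysics.QuantumFieldTheory.ConformalBootstrap3D.HRCoeffHalfBoundTables

/-!
# Two-sign head cells touching the scalar unitarity bound (`ℓ = 0`, cells `[1/2, t₁)`)

Topic `MathematicalPhysics/QuantumFieldTheory/ConformalBootstrap3D`; definitions + theorems only (no
new analytic input). The head-cell rules of `TwoSignHeadCells` for a two-sign row
`Λ(Δ, ℓ) = Σ_k [a⁻_k ∂-structure + a⁺_k ∂-structure]` come in two coefficient modes: MONOTONE tables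
(cell start `a ≥ ℓ + 1`) and INTERVAL tables `hrCoeffLo/Hi` (cell start `a > unitarityBound3D ℓ`).
For a SCALAR row typed from the unitarity bound itself — the default of every numerical bootstrap
system in a sector WITHOUT a gap assumption, e.g. the traceless-symmetric scalars of the `O(N)`
archipelago, `α·V_{T,Δ,0} ≥ 0` for all `Δ ≥ (D-2)/2 = 1/2` (Kos–Poland–Simmons-Duffin–Vichi 2015, §3,
the displayed semidefinite program) — neither mode reaches the first cell: the interval tables blow up
as `a ↓ 1/2` (the free-scalar pole of `A_{2,0}`, pivot `4Δ - 2`).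

This file adds the third mode, HALF tables: the residue-scaled enclosures
`hrCoeffHalfLo/Hi a b n j` of `B_{n,j}(Δ) = (4Δ - 2)·A_{n,j}(Δ)` (`HRCoeffHalfBoundTables`,
`scaled_hrCoeff_sandwich`, valid for `1/2 ≤ a ≤ Δ ≤ b`, `Δ > 1/2`). The head inequality is certified
for the SCALED head `Σ_{(n,j) ∈ F} B_{n,j}(Δ)/λ₀ · T_{n,j}` from ONE number
`headCellSumH a b F Φlo = Σ min(Lo·Φlo, Hi·Φlo) ≥ 0` and divided by `4Δ - 2 > 0` at every REGULAR
point of the cell (`nonneg_of_scaled_nonneg`); the non-regular points of the half-open cell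
`[a, b)` — the bound `Δ = 1/2` itself when `a = 1/2`, where no block exists at all
(`BlockFreeScalarPole`), and the accidental degeneracies — are covered by the limit clause
(`twoSignPositive_of_eventually_right`), exactly as in the other two modes.

* `headCellSumH`, `twoSignPositive_of_headSumH` (regular points of `[a, b]`),
  `twoSignPositive_of_headSumH_Ico` (every point of `[a, b)`);
* `headSumH_twoSign_of_rules` — the tail of the cell discharged by the row's global data ((M) on the
  twist-gap domain `E ≥ E₀`, `j + τ ≤ E`, now with `τ ≤ a`; (T) from ONE apex inequality), external
  dimension over `[s_lo, s_hi]`;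
* numbers `headCellBoundH₂` (corner term bounds) / `headChordBoundH₂` (chord term bounds),
  `headCellNumberH₂ … nF useChord`, and `headCellH₂_twoSign_of_rules`: ONE number `≥ 0` per cell
  `[a, b)` with `1/2 ≤ a`, `τ ≤ a`, `a + n_F + 1 ≥ E₀` ⇒ the row is non-negative on the cell for every
  `s ∈ [s_lo, s_hi]`.

* `headCellNumber₃ … nF useChord useInterval useHalf`, `headCell₃_twoSign_of_rules` — a scalar cell
  with THREE coefficient modes (half | interval | monotone) — and
  `scalarRange_twoSign_of_pointTables₃`: the scalar range `Δ_gap ≤ Δ < E₀` of a row family from finite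
  tables with two coefficient bits per cell (the three-mode form of
  `scalarRange_twoSign_of_pointTables`, consumed by the `O(N)` vector points certificate).

With this cell as cell `0` (`t₀ = 1/2 = Δ_gap`) and the cells of `TwoSignHeadCells` above it,
`scalar_twoSign_of_cells` yields the scalar range obligation of a two-sign row from the unitarity
bound, with no gap assumption.

References: M. Hogervorst, S. Rychkov, Phys. Rev. D 87 (2013) 106004, §3 eq. (3.9)
[cite: HogervorstRychkov2013, §3 eq. (3.9)]; F. Kos, D. Poland, D. Simmons-Duffin, A. Vichi,
JHEP 11 (2015) 106, §3 [cite: KosPolandSimmonsDuffinVichi2015, §3]; F. Kos, D. Poland,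
D. Simmons-Duffin, JHEP 06 (2014) 091, §2.1 (the `O(N)` rows) [cite: KosPolandSimmonsduffin2014ON, §2.1];
R. Rattazzi, V. Rychkov, E. Tonni, A. Vichi, JHEP 12 (2008) 031, §5.5 (cells of a functional
certificate) [cite: RattazziEtAl2008, §5.5].
-/

noncomputable section

namespace Literature.MathematicalPhysics.QuantumFieldTheory.ConformalBootstrap3D

open Set Finset Filter Topology

/-- The scalar unitarity bound in `D = 3` is `1/2`. [folklore] -/
private theorem unitarityBound3D_scalar : unitarityBound3D 0 = 1 / 2 := by
  simp [unitarityBound3D]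

/-! ### The half-table head cell sum and the point rules -/

/-- **Head cell sum, half tables**: `Σ_{q ∈ F} min (Lo_q·Φ_q) (Hi_q·Φ_q)` with the residue-scaled
enclosures `Lo/Hi = hrCoeffHalfLo/Hi a b n j` of `(4Δ-2)·A_{n,j}(Δ)` on `[a, b]` (`ℓ = 0`,
`a ≥ 1/2` allowed to be the bound). A finite rational computation. [cite: HogervorstRychkov2013, §3 eq. (3.9)] -/
def headCellSumH (a b : ℝ) (F : Finset (ℕ × ℕ)) (Φlo : ℕ × ℕ → ℝ) : ℝ :=
  ∑ q ∈ F, min (hrCoeffHalfLo a b q.1 q.2 * Φlo q) (hrCoeffHalfHi a b q.1 q.2 * Φlo q)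

/-- **Half-table head cell rule for scalar two-sign rows, regular points.** Cell `[a, b]` with
`1/2 ≤ a` (the bound itself allowed); if `Φlo q` bounds the row term from below on the cell,
`headCellSumH a b F Φlo ≥ 0`, and every term outside `F` on the descendant range is non-negative for
`E ∈ [a+n, b+n]`, then the row is non-negative at every REGULAR `Δ ∈ [a, b]` (there `Δ > 1/2`, the
scaled head inequality is divided by `4Δ - 2 > 0`). [cite: HogervorstRychkov2013, §3 eq. (3.9)] -/
theorem twoSignPositive_of_headSumH {n : ℕ} (am ap z zb : Fin n → ℝ)
    (hz : ∀ k, z k ∈ Ioo (0 : ℝ) 1) (hzb : ∀ k, zb k ∈ Ioo (0 : ℝ) 1) {a b s : ℝ}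
    (ha : 1 / 2 ≤ a) (F : Finset (ℕ × ℕ)) (Φlo : ℕ × ℕ → ℝ)
    (hΦ : ∀ q ∈ F, ∀ Δ ∈ Icc a b, Φlo q ≤ twoSignTerm am ap z zb s (Δ + (q.1 : ℝ)) q.2)
    (hhead : 0 ≤ headCellSumH a b F Φlo)
    (htail : ∀ q : ℕ × ℕ, q ∉ F → InDescendantRange 0 q.1 q.2 →
      ∀ E ∈ Icc (a + q.1) (b + q.1), 0 ≤ twoSignTerm am ap z zb s E q.2) :
    ∀ Δ ∈ Icc a b, IsRegularPoint3D Δ 0 → TwoSignPositive am ap z zb s Δ 0 := by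
  intro Δ hΔ hreg
  have hbd : unitarityBound3D 0 ≤ Δ := by rw [unitarityBound3D_scalar]; exact ha.trans hΔ.1
  have hlt : unitarityBound3D 0 < Δ := lt_of_le_of_ne hbd (fun h => hreg.1 h.symm)
  have hΔ' : 1 / 2 < Δ := by
    have h := hlt; rw [unitarityBound3D_scalar] at h; exact h
  refine twoSignPositive_of_termwise am ap z zb hz hzb hlt hreg.2 F ?_ ?_
  · -- the head: certify the SCALED head and divide by `4Δ - 2 > 0`
    refine nonneg_of_scaled_nonneg hΔ' ?_
    have hlam : 0 < legendreLam 0 := legendreLam_pos 0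
    have hterm : ∀ q ∈ F,
        (1 / legendreLam 0) *
            min (hrCoeffHalfLo a b q.1 q.2 * Φlo q) (hrCoeffHalfHi a b q.1 q.2 * Φlo q) ≤
          (4 * Δ - 2) * (hrCoeff Δ 0 q.1 q.2 / legendreLam 0 *
            twoSignTerm am ap z zb s (Δ + (q.1 : ℝ)) q.2) := by
      intro q hq
      have hmin := min_halfTables_mul_le ha hΔ' hΔ.1 hΔ.2 q.1 q.2 (hΦ q hq Δ hΔ)
      have hrw : (4 * Δ - 2) * (hrCoeff Δ 0 q.1 q.2 / legendreLam 0 *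
            twoSignTerm am ap z zb s (Δ + (q.1 : ℝ)) q.2) =
          (1 / legendreLam 0) *
            ((4 * Δ - 2) * hrCoeff Δ 0 q.1 q.2 * twoSignTerm am ap z zb s (Δ + (q.1 : ℝ)) q.2) := by
        ring
      rw [hrw]
      exact mul_le_mul_of_nonneg_left hmin (by positivity)
    calc (0 : ℝ) ≤ (1 / legendreLam 0) * headCellSumH a b F Φlo := mul_nonneg (by positivity) hhead
      _ = ∑ q ∈ F, (1 / legendreLam 0) *
            min (hrCoeffHalfLo a b q.1 q.2 * Φlo q) (hrCoeffHalfHi a b q.1 q.2 * Φlo q) := by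
          rw [headCellSumH, Finset.mul_sum]
      _ ≤ ∑ q ∈ F, (4 * Δ - 2) * (hrCoeff Δ 0 q.1 q.2 / legendreLam 0 *
            twoSignTerm am ap z zb s (Δ + (q.1 : ℝ)) q.2) := Finset.sum_le_sum hterm
      _ = (4 * Δ - 2) * ∑ q ∈ F, hrCoeff Δ 0 q.1 q.2 / legendreLam 0 *
            twoSignTerm am ap z zb s (Δ + (q.1 : ℝ)) q.2 := by rw [Finset.mul_sum]
  · -- the tail
    intro q hq hr
    exact htail q hq hr (Δ + (q.1 : ℝ)) ⟨by linarith [hΔ.1], by linarith [hΔ.2]⟩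

/-- **Half-table head cell rule, half-open cell**: every `Δ ∈ [a, b)`; the non-regular points (the
bound `1/2` itself when `a = 1/2`, accidental degeneracies) by the limit clause from the regular
points to their right inside the cell. [cite: HogervorstRychkov2013, §3 eq. (3.9)] -/
theorem twoSignPositive_of_headSumH_Ico {n : ℕ} (am ap z zb : Fin n → ℝ)
    (hz : ∀ k, z k ∈ Ioo (0 : ℝ) 1) (hzb : ∀ k, zb k ∈ Ioo (0 : ℝ) 1) {a b s : ℝ}
    (ha : 1 / 2 ≤ a) (F : Finset (ℕ × ℕ)) (Φlo : ℕ × ℕ → ℝ)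
    (hΦ : ∀ q ∈ F, ∀ Δ ∈ Icc a b, Φlo q ≤ twoSignTerm am ap z zb s (Δ + (q.1 : ℝ)) q.2)
    (hhead : 0 ≤ headCellSumH a b F Φlo)
    (htail : ∀ q : ℕ × ℕ, q ∉ F → InDescendantRange 0 q.1 q.2 →
      ∀ E ∈ Icc (a + q.1) (b + q.1), 0 ≤ twoSignTerm am ap z zb s E q.2) :
    ∀ Δ ∈ Ico a b, TwoSignPositive am ap z zb s Δ 0 := by
  intro Δ hΔ
  have hreg := twoSignPositive_of_headSumH am ap z zb hz hzb ha F Φlo hΦ hhead htail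
  by_cases hr : IsRegularPoint3D Δ 0
  · exact hreg Δ ⟨hΔ.1, hΔ.2.le⟩ hr
  · have hbd : unitarityBound3D 0 ≤ Δ := by rw [unitarityBound3D_scalar]; exact ha.trans hΔ.1
    refine twoSignPositive_of_eventually_right am ap z zb hz hzb s Δ 0 hr ?_
    filter_upwards [eventually_isRegularPoint3D_nhdsGT_of_bound_le hbd, Ioo_mem_nhdsGT hΔ.2]
      with Δ' hΔ'reg hΔ'
    exact ⟨hΔ'reg, hreg Δ' ⟨hΔ.1.trans hΔ'.1.le, hΔ'.2.le⟩ hΔ'reg⟩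

/-! ### The half-table head cell from the row's global data -/

/-- **Half-table head cell from the row's global data (any table of term bounds).** Cell start
`a ≥ 1/2` and `a ≥ τ`; every index outside `F` on the descendant range has `a + n ≥ E₀`, so its terms
live at `E ≥ a + n ≥ j + τ` (`j ≤ n` for `ℓ = 0`), where (M) (`E < E_T`) or the apex rule (T)
(`E ≥ E_T`) applies; external dimension over `[s_lo, s_hi]`. [cite: HogervorstRychkov2013, §3 eq. (3.9)] -/
theorem headSumH_twoSign_of_rules {n : ℕ} (am ap z zb : Fin n → ℝ)
    (hz : ∀ k, z k ∈ Ioo (0 : ℝ) 1) (hzb : ∀ k, zb k ∈ Ioo (0 : ℝ) 1) (hord : ∀ k, zb k ≤ z k)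
    (apex : Fin n) (hapex : 0 ≤ am apex + ap apex) (qd qr : Fin n → ℝ)
    (hqd : ∀ k, 0 < qd k ∧ qd k ≤ 1) (hqr : ∀ k, 0 < qr k ∧ qr k ≤ 1)
    (hdomd : ∀ k, z k * zb k ≤ qd k ^ 2 * (z apex * zb apex) ∧ z k ≤ qd k * z apex)
    (hdomr : ∀ k, (1 - z k) * (1 - zb k) ≤ qr k ^ 2 * (z apex * zb apex) ∧
      1 - zb k ≤ qr k * z apex)
    {slo shi E₀ ET τ : ℝ}
    (hM : ∀ (j : ℕ) (E : ℝ), E₀ ≤ E → E < ET → (j : ℝ) + τ ≤ E → ∀ s ∈ Icc slo shi,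
      0 ≤ twoSignTerm am ap z zb s E j)
    (hB : apexRest₂ (am + ap) (am - ap) z zb apex qd qr slo ET ≤
      (am apex + ap apex) * ((1 - z apex) * (1 - zb apex)) ^ shi)
    {a b : ℝ} (ha : 1 / 2 ≤ a) (haτ : τ ≤ a) (F : Finset (ℕ × ℕ))
    (hF : ∀ q : ℕ × ℕ, q ∉ F → InDescendantRange 0 q.1 q.2 → E₀ ≤ a + q.1)
    (Φlo : ℕ × ℕ → ℝ)
    (hΦ : ∀ q ∈ F, ∀ Δ ∈ Icc a b, ∀ s ∈ Icc slo shi,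
      Φlo q ≤ twoSignTerm am ap z zb s (Δ + (q.1 : ℝ)) q.2)
    (hhead : 0 ≤ headCellSumH a b F Φlo) :
    ∀ s ∈ Icc slo shi, ∀ Δ ∈ Ico a b, TwoSignPositive am ap z zb s Δ 0 := by
  intro s hs
  refine twoSignPositive_of_headSumH_Ico am ap z zb hz hzb ha F Φlo
    (fun q hq Δ hΔ => hΦ q hq Δ hΔ s hs) hhead ?_
  intro q hq hr E hE
  have h1 : q.2 ≤ 0 + q.1 := hr.2.1
  have h2 : (q.2 : ℝ) ≤ (q.1 : ℝ) := by exact_mod_cast (by omega : q.2 ≤ q.1)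
  have hjτ : (q.2 : ℝ) + τ ≤ E := by linarith [hE.1]
  have hjE : (q.2 : ℝ) ≤ E := by linarith [hE.1]
  have hE0 : E₀ ≤ E := (hF q hq hr).trans hE.1
  by_cases hET : E < ET
  · exact hM q.2 E hE0 hET hjτ s hs
  · rw [twoSignTerm_eq_twoWeightEval]
    exact twoWeightEval_zMono_nonneg_of_apex (am + ap) (am - ap) z zb hz hzb hord apex hapex qd qr
      hqd hqr hdomd hdomr hB E (not_lt.1 hET) q.2 hjE s hs

/-! ### The cell numbers (half tables × corner | chord) and one cell from its number -/

/-- Half coefficient tables, corner term bounds on `[a+n, b+n] × [s_lo, s_hi]`.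
[cite: HogervorstRychkov2013, §3 eq. (3.9)] -/
def headCellBoundH₂ {n : ℕ} (am ap z zb : Fin n → ℝ) (a b slo shi : ℝ)
    (F : Finset (ℕ × ℕ)) : ℝ :=
  headCellSumH a b F
    (fun q => cornerBound₂ (am + ap) (am - ap) z zb q.2 (a + q.1) (b + q.1) slo shi)

/-- Half coefficient tables, chord term bounds. [cite: HogervorstRychkov2013, §3 eq. (3.9)] -/
def headChordBoundH₂ {n : ℕ} (am ap z zb : Fin n → ℝ) (a b slo shi : ℝ)
    (F : Finset (ℕ × ℕ)) : ℝ :=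
  headCellSumH a b F
    (fun q => termChordMin₂ (am + ap) (am - ap) z zb q.2 slo shi (a + q.1) (b + q.1))

/-- **The number of a half-table two-sign head cell** (scalar row, cell start `≥ 1/2`) on the
canonical head set `headSet 0 n_F`, with the term-rule bit corner / chord (`useChord`).
[cite: HogervorstRychkov2013, §3 eq. (3.9)] -/
def headCellNumberH₂ {n : ℕ} (am ap z zb : Fin n → ℝ) (a b slo shi : ℝ) (nF : ℕ)
    (useChord : Bool) : ℝ :=
  if useChord then headChordBoundH₂ am ap z zb a b slo shi (headSet 0 nF)
  else headCellBoundH₂ am ap z zb a b slo shi (headSet 0 nF)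

/-- **One half-table two-sign head cell from its number, its term-rule bit and the row's rules.**
Scalar row; cell `[a, b)` with `1/2 ≤ a`, `τ ≤ a`, head level `n_F` with `a + n_F + 1 ≥ E₀`; chord
cells need node ratios `≥ 1/2` for the cell width (and every cell the global `s`-width ratios); ONE
number `headCellNumberH₂ … ≥ 0` ⇒ the row is non-negative on the cell for every `s ∈ [s_lo, s_hi]` —
in particular on the FIRST cell `[1/2, t₁)` of a scalar row typed from the unitarity bound.
[cite: KosPolandSimmonsDuffinVichi2015, §3] -/
theorem headCellH₂_twoSign_of_rules {n : ℕ} (am ap z zb : Fin n → ℝ)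
    (hz : ∀ k, z k ∈ Ioo (0 : ℝ) 1) (hzb : ∀ k, zb k ∈ Ioo (0 : ℝ) 1) (hord : ∀ k, zb k ≤ z k)
    (apex : Fin n) (hapex : 0 ≤ am apex + ap apex) (qd qr : Fin n → ℝ)
    (hqd : ∀ k, 0 < qd k ∧ qd k ≤ 1) (hqr : ∀ k, 0 < qr k ∧ qr k ≤ 1)
    (hdomd : ∀ k, z k * zb k ≤ qd k ^ 2 * (z apex * zb apex) ∧ z k ≤ qd k * z apex)
    (hdomr : ∀ k, (1 - z k) * (1 - zb k) ≤ qr k ^ 2 * (z apex * zb apex) ∧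
      1 - zb k ≤ qr k * z apex)
    {slo shi E₀ ET τ : ℝ}
    (hM : ∀ (j : ℕ) (E : ℝ), E₀ ≤ E → E < ET → (j : ℝ) + τ ≤ E → ∀ s ∈ Icc slo shi,
      0 ≤ twoSignTerm am ap z zb s E j)
    (hB : apexRest₂ (am + ap) (am - ap) z zb apex qd qr slo ET ≤
      (am apex + ap apex) * ((1 - z apex) * (1 - zb apex)) ^ shi)
    (hr : ∀ k, 1 / 2 ≤ ((1 - z k) * (1 - zb k)) ^ (shi - slo) ∧ 1 / 2 ≤ (z k * zb k) ^ (shi - slo))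
    {a b : ℝ} (nF : ℕ) (hnF : E₀ ≤ a + ((nF : ℝ) + 1)) (useChord : Bool)
    (ha : 1 / 2 ≤ a) (haτ : τ ≤ a)
    (hρ : useChord = true → ∀ k, 1 / 2 ≤ (z k * zb k) ^ ((b - a) / 2) ∧
      1 / 2 ≤ ((1 - z k) * (1 - zb k)) ^ ((b - a) / 2))
    (hnum : 0 ≤ headCellNumberH₂ am ap z zb a b slo shi nF useChord) :
    ∀ s ∈ Icc slo shi, ∀ Δ ∈ Ico a b, TwoSignPositive am ap z zb s Δ 0 := by
  -- the two term-bound tables on the shifted cells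
  have hΦc : ∀ q ∈ headSet 0 nF, ∀ Δ ∈ Icc a b, ∀ s ∈ Icc slo shi,
      cornerBound₂ (am + ap) (am - ap) z zb q.2 (a + q.1) (b + q.1) slo shi ≤
        twoSignTerm am ap z zb s (Δ + (q.1 : ℝ)) q.2 :=
    fun q _ Δ hΔ s hs => cornerBound₂_le_twoSignTerm am ap z zb hz hzb q.2
      (⟨by linarith [hΔ.1], by linarith [hΔ.2]⟩ : Δ + (q.1 : ℝ) ∈ Icc (a + q.1) (b + q.1)) hs
  have hΦd : useChord = true → ∀ q ∈ headSet 0 nF, ∀ Δ ∈ Icc a b, ∀ s ∈ Icc slo shi,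
      termChordMin₂ (am + ap) (am - ap) z zb q.2 slo shi (a + q.1) (b + q.1) ≤
        twoSignTerm am ap z zb s (Δ + (q.1 : ℝ)) q.2 := by
    intro hc q _ Δ hΔ s hs
    have hρ' : ∀ k, 1 / 2 ≤ (z k * zb k) ^ ((b + (q.1 : ℝ) - (a + q.1)) / 2) ∧
        1 / 2 ≤ ((1 - z k) * (1 - zb k)) ^ ((b + (q.1 : ℝ) - (a + q.1)) / 2) := by
      intro k; rw [show b + (q.1 : ℝ) - (a + q.1) = b - a by ring]; exact hρ hc k
    exact termChordMin₂_le_twoSignTerm am ap z zb hz hzb q.2 hr hρ'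
      (⟨by linarith [hΔ.1], by linarith [hΔ.2]⟩ : Δ + (q.1 : ℝ) ∈ Icc (a + q.1) (b + q.1)) hs
  have hF : ∀ q : ℕ × ℕ, q ∉ headSet 0 nF → InDescendantRange 0 q.1 q.2 → E₀ ≤ a + q.1 :=
    headSet_off hnF
  cases useChord with
  | false =>
    have hnum' : 0 ≤ headCellBoundH₂ am ap z zb a b slo shi (headSet 0 nF) := by
      simpa [headCellNumberH₂] using hnum
    exact headSumH_twoSign_of_rules am ap z zb hz hzb hord apex hapex qd qr hqd hqr hdomd hdomr
      hM hB ha haτ (headSet 0 nF) hF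
      (fun q => cornerBound₂ (am + ap) (am - ap) z zb q.2 (a + q.1) (b + q.1) slo shi) hΦc hnum'
  | true =>
    have hnum' : 0 ≤ headChordBoundH₂ am ap z zb a b slo shi (headSet 0 nF) := by
      simpa [headCellNumberH₂] using hnum
    exact headSumH_twoSign_of_rules am ap z zb hz hzb hord apex hapex qd qr hqd hqr hdomd hdomr
      hM hB ha haτ (headSet 0 nF) hF
      (fun q => termChordMin₂ (am + ap) (am - ap) z zb q.2 slo shi (a + q.1) (b + q.1)) (hΦd rfl)
      hnum'

/-- **A scalar two-sign row from the unitarity bound, no gap assumption.** Cells `t₀ = 1/2 < t₁ <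
… < t_K = E` with cell `0` a half-table cell and the others proved by any rule give the scalar range
obligation `∀ Δ, 1/2 ≤ Δ → Δ < E → Λ(Δ, 0) ≥ 0` (restatement of `scalar_twoSign_of_cells` with
`Δ_gap = t₀`). [cite: RattazziEtAl2008, §5.5] -/
theorem scalar_twoSign_from_bound_of_cells {n : ℕ} {am ap z zb : Fin n → ℝ} {S : Set ℝ} {E : ℝ}
    (t : ℕ → ℝ) (K : ℕ) (hK : t K = E)
    (hcell : ∀ k < K, ∀ s ∈ S, ∀ Δ ∈ Ico (t k) (t (k + 1)), TwoSignPositive am ap z zb s Δ 0) :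
    ∀ s ∈ S, ∀ Δ : ℝ, t 0 ≤ Δ → Δ < E → TwoSignPositive am ap z zb s Δ 0 :=
  scalar_twoSign_of_cells t K le_rfl hK hcell

/-! ### Scalar cells with a three-valued coefficient mode, and the scalar range from finite tables -/

/-- **The number of a scalar two-sign head cell with THREE coefficient modes**: `useHalf` — half
tables (cell start `≥ 1/2`, `≥ τ`); otherwise `useInterval` — interval tables (start `> 1/2`, `≥ τ`)
or monotone tables (start `≥ 1`); term-rule bit `useChord` in every mode.
[cite: HogervorstRychkov2013, §3 eq. (3.9)] -/
def headCellNumber₃ {n : ℕ} (am ap z zb : Fin n → ℝ) (a b slo shi : ℝ) (nF : ℕ)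
    (useChord useInterval useHalf : Bool) : ℝ :=
  if useHalf then headCellNumberH₂ am ap z zb a b slo shi nF useChord
  else headCellNumber₂ am ap z zb 0 a b slo shi nF useChord useInterval

/-- **One scalar two-sign head cell from its number and its three bits.** The side conditions by
mode: monotone `1 ≤ a`; interval `1/2 < a`, `τ ≤ a`; half `1/2 ≤ a`, `τ ≤ a`; chord cells the node
ratios for the width; every cell `a + n_F + 1 ≥ E₀` and the row's global data.
[cite: HogervorstRychkov2013, §3 eq. (3.9)] -/
theorem headCell₃_twoSign_of_rules {n : ℕ} (am ap z zb : Fin n → ℝ)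
    (hz : ∀ k, z k ∈ Ioo (0 : ℝ) 1) (hzb : ∀ k, zb k ∈ Ioo (0 : ℝ) 1) (hord : ∀ k, zb k ≤ z k)
    (apex : Fin n) (hapex : 0 ≤ am apex + ap apex) (qd qr : Fin n → ℝ)
    (hqd : ∀ k, 0 < qd k ∧ qd k ≤ 1) (hqr : ∀ k, 0 < qr k ∧ qr k ≤ 1)
    (hdomd : ∀ k, z k * zb k ≤ qd k ^ 2 * (z apex * zb apex) ∧ z k ≤ qd k * z apex)
    (hdomr : ∀ k, (1 - z k) * (1 - zb k) ≤ qr k ^ 2 * (z apex * zb apex) ∧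
      1 - zb k ≤ qr k * z apex)
    {slo shi E₀ ET τ : ℝ} (hτ1 : τ ≤ 1)
    (hM : ∀ (j : ℕ) (E : ℝ), E₀ ≤ E → E < ET → (j : ℝ) + τ ≤ E → ∀ s ∈ Icc slo shi,
      0 ≤ twoSignTerm am ap z zb s E j)
    (hB : apexRest₂ (am + ap) (am - ap) z zb apex qd qr slo ET ≤
      (am apex + ap apex) * ((1 - z apex) * (1 - zb apex)) ^ shi)
    (hr : ∀ k, 1 / 2 ≤ ((1 - z k) * (1 - zb k)) ^ (shi - slo) ∧ 1 / 2 ≤ (z k * zb k) ^ (shi - slo))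
    {a b : ℝ} (nF : ℕ) (hnF : E₀ ≤ a + ((nF : ℝ) + 1)) (useChord useInterval useHalf : Bool)
    (h1 : useHalf = false → useInterval = false → (1 : ℝ) ≤ a)
    (h2 : useHalf = false → useInterval = true → (1 / 2 : ℝ) < a ∧ τ ≤ a)
    (h3 : useHalf = true → (1 / 2 : ℝ) ≤ a ∧ τ ≤ a)
    (hρ : useChord = true → ∀ k, 1 / 2 ≤ (z k * zb k) ^ ((b - a) / 2) ∧
      1 / 2 ≤ ((1 - z k) * (1 - zb k)) ^ ((b - a) / 2))
    (hnum : 0 ≤ headCellNumber₃ am ap z zb a b slo shi nF useChord useInterval useHalf) :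
    ∀ s ∈ Icc slo shi, ∀ Δ ∈ Ico a b, TwoSignPositive am ap z zb s Δ 0 := by
  cases useHalf with
  | true =>
    have hnum' : 0 ≤ headCellNumberH₂ am ap z zb a b slo shi nF useChord := by
      simpa [headCellNumber₃] using hnum
    exact headCellH₂_twoSign_of_rules am ap z zb hz hzb hord apex hapex qd qr hqd hqr hdomd hdomr hM hB
      hr nF hnF useChord (h3 rfl).1 (h3 rfl).2 hρ hnum'
  | false =>
    have hnum' : 0 ≤ headCellNumber₂ am ap z zb 0 a b slo shi nF useChord useInterval := by
      simpa [headCellNumber₃] using hnum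
    exact headCell₂_twoSign_of_rules am ap z zb hz hzb hord apex hapex qd qr hqd hqr hdomd hdomr hτ1 hM
      hB hr (ℓ := 0) nF hnF useChord useInterval (fun h => by simpa using h1 rfl h)
      (fun h => ⟨by rw [unitarityBound3D_scalar]; exact (h2 rfl h).1, by simpa using (h2 rfl h).2⟩)
      hρ hnum'

/-- **The scalar range of a two-sign row family from finite tables, three coefficient modes**:
`Δ_gap ≤ Δ < E₀`, every `s ∈ [s_lo, s_hi]`, from half-open head cells `t₀ ≤ Δ_gap`, `t_K = E₀`, each
with a head level, a term bit, TWO coefficient bits (`i`: interval, `h`: half — `h` wins) and ONE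
number `headCellNumber₃ ≥ 0`; the (M) box table with term bits; the apex inequality of the family's
tail; the `s`-width node ratios. With `h 0 = true` the first cell may start AT the unitarity bound
`t₀ = 1/2 = Δ_gap` (a scalar row with no gap assumption). [cite: RattazziEtAl2008, §5.5] -/
theorem scalarRange_twoSign_of_pointTables₃ {n : ℕ} (am ap z zb : Fin n → ℝ)
    (hz : ∀ k, z k ∈ Ioo (0 : ℝ) 1) (hzb : ∀ k, zb k ∈ Ioo (0 : ℝ) 1) (hord : ∀ k, zb k ≤ z k)
    (apex : Fin n) (hapex : 0 ≤ am apex + ap apex) (qd qr : Fin n → ℝ)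
    (hqd : ∀ k, 0 < qd k ∧ qd k ≤ 1) (hqr : ∀ k, 0 < qr k ∧ qr k ≤ 1)
    (hdomd : ∀ k, z k * zb k ≤ qd k ^ 2 * (z apex * zb apex) ∧ z k ≤ qd k * z apex)
    (hdomr : ∀ k, (1 - z k) * (1 - zb k) ≤ qr k ^ 2 * (z apex * zb apex) ∧
      1 - zb k ≤ qr k * z apex)
    {slo shi E₀ ET τ : ℝ} (hτ1 : τ ≤ 1)
    (hr : ∀ k, 1 / 2 ≤ ((1 - z k) * (1 - zb k)) ^ (shi - slo) ∧ 1 / 2 ≤ (z k * zb k) ^ (shi - slo))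
    (e : ℕ → ℕ → ℝ) (M : ℕ → ℕ) (bc : ℕ → ℕ → Bool)
    (he : ∀ j : ℕ, (j : ℝ) + τ < ET → e j 0 ≤ max E₀ ((j : ℝ) + τ) ∧ ET ≤ e j (M j))
    (hρM : ∀ j m, m < M j → bc j m = true → ∀ k, 1 / 2 ≤ (z k * zb k) ^ ((e j (m + 1) - e j m) / 2) ∧
      1 / 2 ≤ ((1 - z k) * (1 - zb k)) ^ ((e j (m + 1) - e j m) / 2))
    (hbox : ∀ j : ℕ, (j : ℝ) + τ < ET → ∀ m < M j,
      0 ≤ boxNumber₂ am ap z zb j (e j m) (e j (m + 1)) slo shi (bc j m))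
    (hB : apexRest₂ (am + ap) (am - ap) z zb apex qd qr slo ET ≤
      (am apex + ap apex) * ((1 - z apex) * (1 - zb apex)) ^ shi)
    {gap : ℝ} (t : ℕ → ℝ) (K : ℕ) (h0 : t 0 ≤ gap) (hK : t K = E₀) (nF : ℕ → ℕ)
    (c i h : ℕ → Bool)
    (h1 : ∀ k < K, h k = false → i k = false → (1 : ℝ) ≤ t k)
    (h2 : ∀ k < K, h k = false → i k = true → (1 / 2 : ℝ) < t k ∧ τ ≤ t k)
    (h3 : ∀ k < K, h k = true → (1 / 2 : ℝ) ≤ t k ∧ τ ≤ t k)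
    (hρ : ∀ k < K, c k = true → ∀ m, 1 / 2 ≤ (z m * zb m) ^ ((t (k + 1) - t k) / 2) ∧
      1 / 2 ≤ ((1 - z m) * (1 - zb m)) ^ ((t (k + 1) - t k) / 2))
    (hnF : ∀ k < K, E₀ ≤ t k + ((nF k : ℝ) + 1))
    (hhead : ∀ k < K,
      0 ≤ headCellNumber₃ am ap z zb (t k) (t (k + 1)) slo shi (nF k) (c k) (i k) (h k)) :
    ∀ s ∈ Icc slo shi, ∀ Δ : ℝ, gap ≤ Δ → Δ < E₀ → TwoSignPositive am ap z zb s Δ 0 := by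
  have hM := ruleM_twoSign_of_boxTable₂ am ap z zb hz hzb τ hr e M bc he hρM hbox
  exact scalar_twoSign_of_cells t K h0 hK fun k hk =>
    headCell₃_twoSign_of_rules am ap z zb hz hzb hord apex hapex qd qr hqd hqr hdomd hdomr hτ1 hM hB hr
      (nF k) (hnF k hk) (c k) (i k) (h k) (h1 k hk) (h2 k hk) (h3 k hk) (hρ k hk) (hhead k hk)

end Literature.MathematicalPhysics.QuantumFieldTheory.ConformalBootstrap3D
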